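import Literature.AlgebraicGeometry.Motives.JacobianBrillNoetherLocusDimension
import Literature.AlgebraicGeometry.Motives.JacobianBrillNoetherLocusPoints
import Literature.AlgebraicGeometry.Motives.GeometricallyIntegralAlgClosed
import Literature.AlgebraicGeometry.Motives.ClosedGraphMorphism
import Literature.Topology.KrullDimensionDrop
import HarnessLib

/-!
# Mumford's translation lemma (Abelian Varieties, §6, Application 1, p. 61)

Topic `Literature/AlgebraicGeometry/Motives`.  The geometric heart of Mumford, *Abelian Varieties*, §6,
Application 1 ("`D` effective, `{x : t_x^*D = D}` finite ⇒ `D` ample"), p. 61: *if an irreducible closed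
subset `Z` of an abelian variety `A` over `k = k̄` is disjoint from a translate of the support `S` of an
effective divisor `D`, then `S` is stable under all translations `t_{z z'⁻¹}`, `z, z' ∈ Z(k)`.*  Mumford
states it for an irreducible CURVE `B` disjoint from `t_x(D)` for a general `x`; the printed proof uses
only irreducibility, and one translate suffices (A-p17 (g10) design datum, cell `hodgecm-mathlib`).
Theorems only — no definition: the auxiliary schemes are variables (`ιS : S' → A`, `ιZ : Z' → A` closed
immersions with integral sources and prescribed ranges; they EXIST on every irreducible closed subset,
`exists_isClosedImmersion_isIntegral_range_eq`) and the morphism `δ_y : S' ×_k Z' → A`,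
`(s, z) ↦ s z⁻¹ y⁻¹`, is pinned by an equation `hδ`.

* `isClosed_range_of_hδ`, `isIrreducible_range_of_hδ` — `δ_y` is proper with irreducible source, so its
  image `T = S · Z⁻¹ · y⁻¹` is closed and irreducible; its `k`-points are the `s z⁻¹ y⁻¹`
  (`pt_mem_range_of_hδ`, `exists_eq_of_pt_mem_range_of_hδ`);
* `one_pt_notMem_range_of_hδ` — if `Z ⊆ t_y⁻¹(A ∖ S)` then `1 ∉ T`, so `T ⊊ A` and `dim T ≤ dim A − 1`;
  but `T ⊇ t_{z⁻¹y⁻¹}(S)` for every `z ∈ Z(k)` (`image_translation_subset_range_of_hδ`), a closed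
  irreducible set of dimension `dim A − 1` when `S` is irreducible, hence `T = t_{z⁻¹y⁻¹}(S)` for all `z`
  (`image_translation_support_eq_range_of_hδ`) and `t_{z z'⁻¹}(S) = S`
  (`image_translation_support_eq_of_subset_preimage`, the head).

The transfer «set-theoretic stabiliser ⇒ `K(D)`» for a multiplicity-one irreducible support is the sequel
`AbelianVarietySupportStabilizerKTheta.lean`.  All inputs are in the tree: dimensions of supports and
translates (`AbelianVariety.topologicalKrullDim_support_eq`, `topologicalKrullDim_image_translation`),
geometric integrality over `k = k̄` (`geometricallyIntegral_of_isAlgClosed`), `k`-points over images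
(`Morphisms.exists_over_comp_eq_of_mem_range`), `k`-points versus closed points (`AlgPoints.eq_of_pt_eq`,
`exists_pt_eq_of_isClosed_singleton`), the dimension drop of proper closed subsets
(`Literature.Topology.topologicalKrullDim_lt_of_forall_exists_specializes`).

## References
* [MumfordAV1970] D. Mumford, *Abelian Varieties* (1970), §6, Application 1 and the Lemma on p. 61.
* [GortzWedhorn2023] U. Görtz, T. Wedhorn, *Algebraic Geometry II*, Def./Rem. 27.1 (translations), Prop. 27.174
  and Lemma 27.175 (the affine-complement form of Application 1, ★ `isAmple_of_isEffective_of_avoids_iff`).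
* [Hartshorne1977] R. Hartshorne, *Algebraic Geometry*, II Example 3.2.6 (reduced induced closed subscheme),
  II Ex. 3.11 (d).
-/

noncomputable section

open CategoryTheory CategoryTheory.Limits AlgebraicGeometry MonoidalCategory CartesianMonoidalCategory
open TopologicalSpace Topology
open scoped MonObj
open Scheme.IdealSheafData

universe u

namespace Literature.AlgebraicGeometry.Motives

namespace AbelianVariety

variable {k : Type u} [Field k] (A : AbelianVariety k)

/-! ## §0 Bookkeeping in `SchemeOver k` -/

/-- The structure morphism of `Spec k` over itself is the identity. [folklore] -/
private theorem specOver_self_hom'' : (specOver k k).hom = 𝟙 (Spec (.of k)) := by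
  change Spec.map (CommRingCat.ofHom (RingHom.id k)) = _
  rw [CommRingCat.ofHom_id]
  exact Spec.map_id _

/-- Any `k`-morphism followed by the structure morphism of its target is the structure morphism of
its source. [folklore] -/
private theorem comp_toSpecOver_eq_aux {Y X : SchemeOver k} (g : Y ⟶ X) : g ≫ toSpecOver X = toSpecOver Y := by
  apply Over.OverMorphism.ext
  change g.left ≫ X.hom = Y.hom
  exact Over.w g

/-- The structure morphism of `Spec k` to itself, as a `k`-morphism, is the identity. [folklore] -/
private theorem toSpecOver_specOver : toSpecOver (specOver k k) = 𝟙 (specOver k k) := by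
  apply Over.OverMorphism.ext
  change (specOver k k).hom = 𝟙 _
  exact specOver_self_hom''

/-- A `k`-point precomposed to a constant point `T → Spec k → A` is that point. [folklore] -/
private theorem point_comp_toSpecOver_comp {T : SchemeOver k} (w : AlgPoints T k) (P : A.Points k) :
    w ≫ (toSpecOver T ≫ P) = P := by
  rw [← Category.assoc, comp_toSpecOver_eq_aux, toSpecOver_specOver, Category.id_comp]

/-! ## §1 Integral closed subschemes on irreducible closed subsets, as `k`-schemes -/

/-- **Every irreducible closed subset of `A` is the range of a closed immersion of `k`-schemes from an
INTEGRAL `k`-scheme** (the reduced induced closed subscheme; Hartshorne II Example 3.2.6, Ex. 3.11 (d)).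
[cite: Hartshorne1977, II Example 3.2.6 and Ex. 3.11 (d)] -/
theorem exists_isClosedImmersion_isIntegral_range_eq {Z : Set A.X.left} (hZc : IsClosed Z) (hZi : IsIrreducible Z) :
    ∃ (W : SchemeOver k) (j : W ⟶ A.X), IsClosedImmersion j.left ∧ IsIntegral W.left ∧ Set.range j.left.base = Z := by
  let Zc : Closeds A.X.left := ⟨Z, hZc⟩
  refine ⟨Over.mk ((vanishingIdeal Zc).subschemeι ≫ A.X.hom), Over.homMk (vanishingIdeal Zc).subschemeι rfl,
    inferInstanceAs (IsClosedImmersion (vanishingIdeal Zc).subschemeι),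
    isIntegral_subscheme_vanishingIdeal_of_isIrreducible Zc hZi, ?_⟩
  exact range_subschemeι_vanishingIdeal_eq Zc

section Sub

variable {W : SchemeOver k} (j : W ⟶ A.X) [IsClosedImmersion j.left]

include j in
/-- The structure morphism of a closed `k`-subscheme of `A` is locally of finite type. [folklore] -/
private theorem locallyOfFiniteType_hom_of_isClosedImmersion : LocallyOfFiniteType W.hom := by
  rw [← Over.w j]; infer_instance

include j in
/-- The structure morphism of a closed `k`-subscheme of `A` is proper. [folklore] -/
private theorem isProper_hom_of_isClosedImmersion : IsProper W.hom := by
  haveI := A.isProper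
  rw [← Over.w j]; infer_instance

/-- Every `k`-point of `A` on the range of a closed immersion `j : W → A` lifts to a `k`-point of `W`
(`k` algebraically closed). [cite: Hartshorne1977, II Ex. 3.11 (d)] -/
theorem exists_comp_eq_of_pt_mem_range [IsAlgClosed k] {z : A.Points k} (hz : z.pt ∈ Set.range j.left.base) :
    ∃ z' : AlgPoints W k, z' ≫ j = z := by
  haveI := A.locallyOfFiniteType_hom_of_isClosedImmersion j
  haveI : LocallyOfFiniteType j.left := inferInstance
  exact Morphisms.exists_over_comp_eq_of_mem_range j (specOver k k).hom z hz

end Sub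

/-! ## §2 The morphism `(s, z) ↦ s · z⁻¹ · y⁻¹` on `S' ×_k Z'` -/

section DivTranslate

variable {S' Z' : SchemeOver k} (ιS : S' ⟶ A.X) (ιZ : Z' ⟶ A.X) [IsClosedImmersion ιS.left] [IsClosedImmersion ιZ.left]
  (y : A.Points k) (δ : S' ⊗ Z' ⟶ A.X)
  (hδ : δ = ((CartesianMonoidalCategory.fst _ _ ≫ ιS) * (CartesianMonoidalCategory.snd _ _ ≫ ιZ)⁻¹) *
    (toSpecOver (S' ⊗ Z') ≫ y⁻¹))

omit [IsClosedImmersion ιS.left] [IsClosedImmersion ιZ.left] in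
include hδ in
/-- On `k`-points, `δ_y (s, z) = s z⁻¹ y⁻¹`. [cite: MumfordAV1970, §6 Application 1, Lemma p. 61] -/
theorem comp_eq_of_hδ (w : AlgPoints (S' ⊗ Z') k) :
    w ≫ δ = ((w ≫ CartesianMonoidalCategory.fst _ _ ≫ ιS) * (w ≫ CartesianMonoidalCategory.snd _ _ ≫ ιZ)⁻¹) * y⁻¹ := by
  subst hδ
  rw [MonObj.comp_mul, MonObj.comp_mul, GrpObj.comp_inv, point_comp_toSpecOver_comp]

/-- The product `X₁ ×_k X₂` of `k`-schemes locally of finite type with `X₁`, `X₂` integral is integral (`k`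
algebraically closed: `X₁` is geometrically integral, Mathlib `IsIntegral (pullback f g)`).
[cite: MumfordAV1970, §6 Application 1, Lemma p. 61] -/
theorem isIntegral_tensor_left_of_locallyOfFiniteType {X₁ X₂ : SchemeOver k} [IsAlgClosed k]
    [LocallyOfFiniteType X₁.hom] [LocallyOfFiniteType X₂.hom] [IsIntegral X₁.left] [IsIntegral X₂.left] :
    IsIntegral (X₁ ⊗ X₂).left := by
  haveI : GeometricallyIntegral X₁.hom := geometricallyIntegral_of_isAlgClosed _
  haveI : LocallyOfFinitePresentation X₁.hom := inferInstance
  haveI : UniversallyOpen X₁.hom := inferInstance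
  haveI : IsLocallyNoetherian X₂.left := LocallyOfFiniteType.isLocallyNoetherian X₂.hom
  change IsIntegral (pullback X₁.hom X₂.hom)
  infer_instance

include ιS ιZ in
/-- Any `k`-morphism `S' ×_k Z' → A` is proper (its source is proper over `k`, its target separated).
[cite: MumfordAV1970, §6 Application 1, Lemma p. 61] -/
theorem isProper_left_tensor (g : S' ⊗ Z' ⟶ A.X) : IsProper g.left := by
  haveI := A.isProper
  haveI := A.isProper_hom_of_isClosedImmersion ιS
  haveI := A.isProper_hom_of_isClosedImmersion ιZ
  haveI : IsProper ((S' ⊗ Z').hom) := by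
    change IsProper (pullback.fst S'.hom Z'.hom ≫ S'.hom)
    infer_instance
  haveI : IsProper (g.left ≫ A.X.hom) := by
    rw [Over.w]; infer_instance
  exact IsProper.of_comp g.left A.X.hom

include ιS ιZ in
/-- The image `T = S · Z⁻¹ · y⁻¹` of `δ_y` is closed. [cite: MumfordAV1970, §6 Application 1, Lemma p. 61] -/
theorem isClosed_range_of_hδ : IsClosed (Set.range δ.left.base) := by
  haveI := A.isProper_left_tensor ιS ιZ δ
  exact δ.left.isClosedMap.isClosed_range

include ιS ιZ in
/-- The image of `δ_y` is irreducible (for `S'`, `Z'` integral). [cite: MumfordAV1970, §6 Application 1, Lemma p. 61] -/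
theorem isIrreducible_range_of_hδ [IsAlgClosed k] [IsIntegral S'.left] [IsIntegral Z'.left] :
    IsIrreducible (Set.range δ.left.base) := by
  haveI := A.locallyOfFiniteType_hom_of_isClosedImmersion ιS
  haveI := A.locallyOfFiniteType_hom_of_isClosedImmersion ιZ
  haveI : IsIntegral (S' ⊗ Z').left := isIntegral_tensor_left_of_locallyOfFiniteType
  rw [← Set.image_univ]
  exact (IrreducibleSpace.isIrreducible_univ _).image _ δ.left.continuous.continuousOn

include hδ in
/-- The points `s z⁻¹ y⁻¹`, `s ∈ S(k)`, `z ∈ Z(k)`, lie in the image of `δ_y`. [cite: MumfordAV1970, §6 Application 1, Lemma p. 61] -/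
theorem pt_mem_range_of_hδ [IsAlgClosed k] {s z : A.Points k} (hs : s.pt ∈ Set.range ιS.left.base)
    (hz : z.pt ∈ Set.range ιZ.left.base) : (s * z⁻¹ * y⁻¹).pt ∈ Set.range δ.left.base := by
  obtain ⟨s', hs'⟩ := A.exists_comp_eq_of_pt_mem_range ιS hs
  obtain ⟨z', hz'⟩ := A.exists_comp_eq_of_pt_mem_range ιZ hz
  let w : AlgPoints (S' ⊗ Z') k := CartesianMonoidalCategory.lift s' z'
  have hw : w ≫ δ = s * z⁻¹ * y⁻¹ := by
    rw [A.comp_eq_of_hδ ιS ιZ y δ hδ, CartesianMonoidalCategory.lift_fst_assoc,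
      CartesianMonoidalCategory.lift_snd_assoc, hs', hz']
  refine ⟨w.pt, ?_⟩
  rw [← hw]
  rfl

include hδ in
/-- Every `k`-point of the image of `δ_y` is of the form `s z⁻¹ y⁻¹` with `s ∈ S(k)`, `z ∈ Z(k)`.
[cite: MumfordAV1970, §6 Application 1, Lemma p. 61] -/
theorem exists_eq_of_pt_mem_range_of_hδ [IsAlgClosed k] {t : A.Points k} (ht : t.pt ∈ Set.range δ.left.base) :
    ∃ s z : A.Points k, s.pt ∈ Set.range ιS.left.base ∧ z.pt ∈ Set.range ιZ.left.base ∧ t = s * z⁻¹ * y⁻¹ := by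
  haveI := A.isProper_left_tensor ιS ιZ δ
  obtain ⟨w₀, hw₀⟩ := Morphisms.exists_over_comp_eq_of_mem_range δ (specOver k k).hom t ht
  let w : AlgPoints (S' ⊗ Z') k := w₀
  have hw : w ≫ δ = t := hw₀
  let s : AlgPoints S' k := w ≫ CartesianMonoidalCategory.fst _ _
  let z : AlgPoints Z' k := w ≫ CartesianMonoidalCategory.snd _ _
  refine ⟨s ≫ ιS, z ≫ ιZ, ⟨s.pt, rfl⟩, ⟨z.pt, rfl⟩, ?_⟩
  rw [← hw, A.comp_eq_of_hδ ιS ιZ y δ hδ]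
  rfl

end DivTranslate

/-! ## §3 Mumford's translation lemma -/

section Lemma

variable [IsAlgClosed k] {D : CartierDivisor A.X.left}
  {S' Z' : SchemeOver k} (ιS : S' ⟶ A.X) (ιZ : Z' ⟶ A.X) [IsClosedImmersion ιS.left] [IsClosedImmersion ιZ.left]
  (hS : Set.range ιS.left.base = (D.nonvanishing 1)ᶜ)
  (y : A.Points k) (δ : S' ⊗ Z' ⟶ A.X)
  (hδ : δ = ((CartesianMonoidalCategory.fst _ _ ≫ ιS) * (CartesianMonoidalCategory.snd _ _ ≫ ιZ)⁻¹) *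
    (toSpecOver (S' ⊗ Z') ≫ y⁻¹))

include hS hδ in
/-- **`1 ∉ S · Z⁻¹ · y⁻¹` when `t_y(Z) ∩ S = ∅`**: if `Z ⊆ t_y⁻¹(A ∖ S)` then the unit point is not in
the image of `δ_y` (a relation `s z⁻¹ y⁻¹ = 1` would give `t_y(z) = y z = s ∈ S`).
[cite: MumfordAV1970, §6 Application 1, Lemma p. 61] -/
theorem one_pt_notMem_range_of_hδ (hy : Set.range ιZ.left.base ⊆ (A.translation y).left.base ⁻¹' (D.nonvanishing 1)) :
    (1 : A.Points k).pt ∉ Set.range δ.left.base := by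
  intro h1
  obtain ⟨s, z, hs, hz, hszy⟩ := A.exists_eq_of_pt_mem_range_of_hδ ιS ιZ y δ hδ h1
  have hs' : s = y * z := by
    have := hszy.symm
    rw [mul_inv_eq_one, mul_inv_eq_iff_eq_mul] at this
    rw [this, mul_comm]
  have hmem : (A.translation y).left.base z.pt ∈ D.nonvanishing 1 := hy hz
  rw [translation_apply_pt, ← hs'] at hmem
  rw [hS] at hs
  exact hs hmem

omit [IsAlgClosed k] in
/-- The closed points of a translate `t_w(S)` of a set are the `t_w(pt s)`, `s ∈ S(k)` (`k`
algebraically closed). [folklore] -/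
private theorem image_translation_inter_closedPoints_subset [IsAlgClosed k] (S : Set A.X.left) (w : A.Points k)
    (T : Set A.X.left) (hT : ∀ s : A.Points k, s.pt ∈ S → (w * s).pt ∈ T) :
    (A.translation w).left.base '' S ∩ closedPoints A.X.left ⊆ T := by
  rintro _ ⟨⟨x, hxS, rfl⟩, hcl⟩
  haveI : LocallyOfFiniteType A.X.hom := inferInstance
  -- the point `x = t_{w⁻¹}(t_w x)` is closed
  have hxcl : IsClosed ({x} : Set A.X.left) := by
    have e : x = (A.translation w⁻¹).left.base ((A.translation w).left.base x) := by
      rw [← Scheme.Hom.comp_apply, ← Over.comp_left, translation_comp_translation_inv]; rfl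
    rw [e]
    have himg := (A.translation w⁻¹).left.homeomorph.isClosedMap _ (mem_closedPoints_iff.mp hcl)
    rwa [Set.image_singleton] at himg
  obtain ⟨s, hs⟩ := AlgPoints.exists_pt_eq_of_isClosed_singleton (X := A.X) hxcl
  rw [← hs, translation_apply_pt]
  exact hT s (hs ▸ hxS)

include hδ in
/-- **`t_{z⁻¹ y⁻¹}(S) ⊆ S · Z⁻¹ · y⁻¹`** for `z ∈ Z(k)` (closed points first, then Jacobson density).
[cite: MumfordAV1970, §6 Application 1, Lemma p. 61] -/
theorem image_translation_subset_range_of_hδ {z : A.Points k} (hz : z.pt ∈ Set.range ιZ.left.base) :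
    (A.translation (z⁻¹ * y⁻¹)).left.base '' Set.range ιS.left.base ⊆ Set.range δ.left.base := by
  haveI : JacobsonSpace A.X.left := LocallyOfFiniteType.jacobsonSpace A.X.hom
  have hScl : IsClosed (Set.range ιS.left.base) := ιS.left.isClosedEmbedding.isClosed_range
  have hcl : IsClosed ((A.translation (z⁻¹ * y⁻¹)).left.base '' Set.range ιS.left.base) :=
    (A.translation (z⁻¹ * y⁻¹)).left.homeomorph.isClosedMap _ hScl
  have hpts : (A.translation (z⁻¹ * y⁻¹)).left.base '' Set.range ιS.left.base ∩ closedPoints A.X.left ⊆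
      Set.range δ.left.base := by
    refine A.image_translation_inter_closedPoints_subset _ _ _ fun s hs => ?_
    have e : z⁻¹ * y⁻¹ * s = s * z⁻¹ * y⁻¹ := by
      rw [mul_comm, ← mul_assoc]
    rw [e]
    exact A.pt_mem_range_of_hδ ιS ιZ y δ hδ hs hz
  calc (A.translation (z⁻¹ * y⁻¹)).left.base '' Set.range ιS.left.base
      = closure ((A.translation (z⁻¹ * y⁻¹)).left.base '' Set.range ιS.left.base ∩ closedPoints A.X.left) :=
        (JacobsonSpace.closure_inter_closedPoints hcl).symm
    _ ⊆ Set.range δ.left.base := closure_minimal hpts (A.isClosed_range_of_hδ ιS ιZ δ)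

include hS hδ in
/-- **`t_{z⁻¹ y⁻¹}(S) = S · Z⁻¹ · y⁻¹`** for every `z ∈ Z(k)`, when `S = Supp D` is irreducible, `Z'` is
integral and `t_y(Z) ∩ S = ∅`: both sides are closed irreducible, the left one of dimension `dim A − 1`,
the right one a proper subset of `A` (it misses `1`), hence of dimension `≤ dim A − 1`.
[cite: MumfordAV1970, §6 Application 1, Lemma p. 61] -/
theorem image_translation_support_eq_range_of_hδ [IsIntegral S'.left] [IsIntegral Z'.left] (hD : D.IsEffective)
    (hirr : IsIrreducible (D.nonvanishing 1)ᶜ)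
    (hy : Set.range ιZ.left.base ⊆ (A.translation y).left.base ⁻¹' (D.nonvanishing 1))
    {z : A.Points k} (hz : z.pt ∈ Set.range ιZ.left.base) :
    (A.translation (z⁻¹ * y⁻¹)).left.base '' (D.nonvanishing 1)ᶜ = Set.range δ.left.base := by
  haveI := A.irreducibleSpace_left
  set T := Set.range δ.left.base with hT
  set Sw := (A.translation (z⁻¹ * y⁻¹)).left.base '' (D.nonvanishing 1)ᶜ with hSw
  have hsub : Sw ⊆ T := by
    rw [hSw, ← hS]
    exact A.image_translation_subset_range_of_hδ ιS ιZ y δ hδ hz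
  have hTcl : IsClosed T := A.isClosed_range_of_hδ ιS ιZ δ
  have hTirr : IsIrreducible T := A.isIrreducible_range_of_hδ ιS ιZ δ
  have hSwcl : IsClosed Sw := (A.translation (z⁻¹ * y⁻¹)).left.homeomorph.isClosedMap _
    (D.isOpen_nonvanishing 1).isClosed_compl
  -- dimensions: `dim Sw = dim A − 1`, `dim T < dim A`
  have hdimS : topologicalKrullDim ↥Sw = ((A.dim - 1 : ℕ) : WithBot ℕ∞) := by
    rw [hSw, A.topologicalKrullDim_image_translation, A.topologicalKrullDim_support_eq hD hirr]
  have hTne : T ≠ Set.univ := fun h =>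
    A.one_pt_notMem_range_of_hδ ιS ιZ hS y δ hδ hy (by rw [← hT, h]; exact Set.mem_univ _)
  have hdimT0 : topologicalKrullDim ↥T < ((A.dim : ℕ) : WithBot ℕ∞) := by
    refine Literature.Topology.topologicalKrullDim_lt_of_isClosed_ssubset hTcl hTne A.dim ?_
    rw [A.topologicalKrullDim_left]
    exact_mod_cast WithBot.coe_lt_coe.mpr (ENat.coe_lt_coe.mpr (Nat.lt_succ_self _))
  have hdimT : topologicalKrullDim ↥T < ((A.dim - 1 + 1 : ℕ) : WithBot ℕ∞) := by
    refine lt_of_lt_of_le hdimT0 ?_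
    have hk : A.dim ≤ A.dim - 1 + 1 := by omega
    exact_mod_cast WithBot.coe_le_coe.mpr (ENat.coe_le_coe.mpr hk)
  -- if `Sw ⊊ T`, the generic point of `T` generises `Sw` from outside, and `dim Sw < dim A − 1`
  by_contra hne
  have hss : Sw ⊂ T := hsub.ssubset_of_ne hne
  obtain ⟨τ, hτ⟩ := QuasiSober.sober hTirr hTcl
  have hτSw : τ ∉ Sw := by
    intro hτ'
    apply hss.2
    have : closure ({τ} : Set A.X.left) ⊆ Sw := closure_minimal (Set.singleton_subset_iff.mpr hτ') hSwcl
    rwa [hτ.def] at this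
  have hlt := Literature.Topology.topologicalKrullDim_lt_of_forall_exists_specializes hTcl hSwcl hsub
    (fun x hx => ⟨τ, hτ.mem, hτSw, hτ.specializes (hsub hx)⟩) (A.dim - 1) hdimT
  rw [hdimS] at hlt
  exact lt_irrefl _ hlt

omit ιS ιZ hS y δ hδ

/-- **Mumford's translation lemma** (*Abelian Varieties*, §6, Application 1, Lemma p. 61; one translate
suffices).  Let `A` be an abelian variety over an algebraically closed field `k`, `D` an effective
Cartier divisor on `A` with irreducible support `S = A ∖ X_1`, `Z ⊆ A` an irreducible closed subset and
`y ∈ A(k)` with `t_y(Z) ∩ S = ∅` (i.e. `Z ⊆ t_y⁻¹(A ∖ S)`).  Then for all `k`-points `z, z'` on `Z`,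
the translation `t_{z z'⁻¹}` maps `S` onto itself. [cite: MumfordAV1970, §6 Application 1, Lemma p. 61] -/
theorem image_translation_support_eq_of_subset_preimage (hD : D.IsEffective)
    (hirr : IsIrreducible (D.nonvanishing 1)ᶜ) {Z : Set A.X.left} (hZc : IsClosed Z) (hZi : IsIrreducible Z)
    (y : A.Points k) (hy : Z ⊆ (A.translation y).left.base ⁻¹' (D.nonvanishing 1))
    {z z' : A.Points k} (hz : z.pt ∈ Z) (hz' : z'.pt ∈ Z) :
    (A.translation (z * z'⁻¹)).left.base '' (D.nonvanishing 1)ᶜ = (D.nonvanishing 1)ᶜ := by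
  -- integral closed subschemes on `S` and `Z`, and the morphism `δ_y`
  obtain ⟨S', ιS, hιS, hS'int, hS⟩ := A.exists_isClosedImmersion_isIntegral_range_eq
    (D.isOpen_nonvanishing 1).isClosed_compl hirr
  obtain ⟨Z', ιZ, hιZ, hZ'int, hZ⟩ := A.exists_isClosedImmersion_isIntegral_range_eq hZc hZi
  haveI := hιS; haveI := hιZ; haveI := hS'int; haveI := hZ'int
  set δ : S' ⊗ Z' ⟶ A.X := ((CartesianMonoidalCategory.fst _ _ ≫ ιS) * (CartesianMonoidalCategory.snd _ _ ≫ ιZ)⁻¹) *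
    (toSpecOver (S' ⊗ Z') ≫ y⁻¹) with hδ
  rw [← hZ] at hy hz hz'
  have e1 := A.image_translation_support_eq_range_of_hδ ιS ιZ hS y δ hδ hD hirr hy hz
  have e2 := A.image_translation_support_eq_range_of_hδ ιS ιZ hS y δ hδ hD hirr hy hz'
  -- `t_{z'⁻¹y⁻¹}(S) = t_{z⁻¹y⁻¹}(S)`; apply `t_{y z}` to both sides
  have e3 : (A.translation (z'⁻¹ * y⁻¹)).left.base '' (D.nonvanishing 1)ᶜ =
      (A.translation (z⁻¹ * y⁻¹)).left.base '' (D.nonvanishing 1)ᶜ := by rw [e2, e1]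
  have key : ∀ P Q : A.Points k, (A.translation Q).left.base '' ((A.translation P).left.base '' (D.nonvanishing 1)ᶜ)
      = (A.translation (Q * P)).left.base '' (D.nonvanishing 1)ᶜ := by
    intro P Q
    rw [Set.image_image, ← A.translation_comp P Q, Over.comp_left, Scheme.Hom.comp_base, TopCat.coe_comp]
    rfl
  have e4 := congrArg (fun W => (A.translation (y * z)).left.base '' W) e3
  simp only [key] at e4
  have h5 : y * z * (z'⁻¹ * y⁻¹) = z * z'⁻¹ := by
    rw [mul_comm z'⁻¹ y⁻¹, ← mul_assoc, mul_comm y z, mul_assoc z y y⁻¹, mul_inv_cancel, mul_one]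
  have h6 : y * z * (z⁻¹ * y⁻¹) = 1 := by
    rw [← mul_assoc, mul_assoc y z z⁻¹, mul_inv_cancel, mul_one, mul_inv_cancel]
  rw [h5, h6, translation_one] at e4
  rw [e4]
  ext x
  simp

end Lemma

end AbelianVariety

end Literature.AlgebraicGeometry.Motives

end
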